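import Mathlib

/-!
# `SqrtFiveQuarticCovers.GroupCensusFive` — helper lemmas (finite group theory in `GL₂(𝔽₅)`)

Support file (`--supports stmt-Langlands-17592`) for the route item
`Summit.Langlands.Langlands.Theses.SqrtFiveQuarticCovers.GroupCensusFive` (the finite census
"every `G ≤ GL₂(𝔽₅)` with `det G ⊆ {±1}`, an element of trace `0` and determinant `-1`, no common
`𝔽₅`-eigenline and `span (G ∩ SL₂) ≠ M₂(𝔽₅)` is conjugate into `H8 = ⟨diag(2,3), antidiag(1,1)⟩`
or `H12 = ⟨(3 1;3 3), diag(1,4)⟩`", Freitas–Le Hung–Siksek 2015, Remark (iii) after Cor. 2.1: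
"three subgroups of orders `6`, `8` and `12`").  The census is NOT proved by enumerating the
subgroups of the `480`-element group; it is proved structurally (main file
`SqrtFiveQuarticCoversGroupCensusFive.lean`), and every residual finite check is a `decide` over at
most six elements of `ZMod 5`.  This file holds the reusable, statement-independent pieces:

* word certificates: explicit descriptions of `H8` (diagonal of determinant `1` or antidiagonal of
  determinant `-1`) and `H12` (commuting with `a = (3 1;3 3)` with determinant `1`, or `g·f`
  commuting with `a` with determinant `-1`) imply membership in the `Subgroup.closure`s of the
  route statement (`mem_H8_of_shape`, `mem_H12_of_shape`);
* `2 × 2` bookkeeping over `ZMod 5` (`mul_self_eq_one_of_trace_zero`, rational canonical form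
  `exists_conj_eq_normalForm` of a non-scalar element of determinant `1`: one of five normal forms
  `diag(2,3)`, `(0 4;1 1)`, `(1 1;0 1)`, `(4 4;0 4)`, `(0 4;1 4)` according to the trace);
* transport of the four census hypotheses and of the conclusion along an inner automorphism
  (`Subgroup.map (MulAut.conj y)`).

No definitions; standard axioms only. References: [FreitasLeHungSiksek2015] N. Freitas,
B. V. Le Hung, S. Siksek, Invent. Math. 201 (2015), Remark (iii) after Cor. 2.1 and Lemma 3.2.
-/

set_option linter.dupNamespace false -- project-wide option (lakefile weak.linter.dupNamespace); `Summit.Langlands.Langlands` is the mandated namespace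

namespace Summit.Langlands.Langlands.Theorems.GroupCensusFive

open Matrix

/-! ## 1. Words: membership in a two-generator closure -/

/-- `a ^ i * f ^ j` lies in the subgroup generated by `a` and `f`. [folklore] -/
theorem mem_closure_pair_of_eq {Γ : Type*} [Group Γ] {a f u : Γ} (i j : ℕ)
    (h : u = a ^ i * f ^ j) : u ∈ Subgroup.closure ({a, f} : Set Γ) := by
  subst h
  refine Subgroup.mul_mem _ (Subgroup.pow_mem _ (Subgroup.subset_closure ?_) _)
    (Subgroup.pow_mem _ (Subgroup.subset_closure ?_) _) <;> simp

/-- Every `2 × 2` matrix over `ZMod 5` is `!![a, b; c, d]` for its four entries. [folklore] -/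
theorem exists_eq_fin_two (m : Matrix (Fin 2) (Fin 2) (ZMod 5)) :
    ∃ a b c d : ZMod 5, m = !![a, b; c, d] :=
  ⟨m 0 0, m 0 1, m 1 0, m 1 1, Matrix.eta_fin_two m⟩

/-- **`H8` by shape.** A unit of `M₂(𝔽₅)` which is diagonal of determinant `1`, or antidiagonal of
determinant `-1`, lies in `H8 = ⟨diag(2,3), antidiag(1,1)⟩` (indeed `H8` is exactly the set of
such matrices: `diag(a, a⁻¹)` and `antidiag(x, x⁻¹)`). [cite: FreitasLeHungSiksek2015, Remark (iii) after Cor. 2.1] -/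
theorem mem_H8_of_shape (u : GL (Fin 2) (ZMod 5))
    (h : ((u : Matrix (Fin 2) (Fin 2) (ZMod 5)) 0 1 = 0 ∧ (u : Matrix (Fin 2) (Fin 2) (ZMod 5)) 1 0 = 0 ∧
        Matrix.det (u : Matrix (Fin 2) (Fin 2) (ZMod 5)) = 1) ∨
      ((u : Matrix (Fin 2) (Fin 2) (ZMod 5)) 0 0 = 0 ∧ (u : Matrix (Fin 2) (Fin 2) (ZMod 5)) 1 1 = 0 ∧
        Matrix.det (u : Matrix (Fin 2) (Fin 2) (ZMod 5)) = -1)) :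
    u ∈ Subgroup.closure ({(⟨!![2, 0; 0, 3], !![3, 0; 0, 2], by decide, by decide⟩ : GL (Fin 2) (ZMod 5)),
      (⟨!![0, 1; 1, 0], !![0, 1; 1, 0], by decide, by decide⟩ : GL (Fin 2) (ZMod 5))} :
        Set (GL (Fin 2) (ZMod 5))) := by
  obtain ⟨a, b, c, d, hu⟩ := exists_eq_fin_two (u : Matrix (Fin 2) (Fin 2) (ZMod 5))
  rw [hu, Matrix.det_fin_two_of] at h
  simp only [Matrix.of_apply, Matrix.cons_val', Matrix.cons_val_zero, Matrix.cons_val_one,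
    Matrix.cons_val_fin_one, Matrix.empty_val'] at h
  have key : !![a, b; c, d] = !![1, 0; 0, 1] ∨ !![a, b; c, d] = !![2, 0; 0, 3] ∨
      !![a, b; c, d] = !![4, 0; 0, 4] ∨ !![a, b; c, d] = !![3, 0; 0, 2] ∨
      !![a, b; c, d] = !![0, 1; 1, 0] ∨ !![a, b; c, d] = !![0, 2; 3, 0] ∨
      !![a, b; c, d] = !![0, 4; 4, 0] ∨ !![a, b; c, d] = !![0, 3; 2, 0] := by
    clear hu; revert a b c d h; decide
  rw [← hu] at key
  rcases key with k | k | k | k | k | k | k | k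
  · exact mem_closure_pair_of_eq 0 0 (Units.ext (k.trans (by decide)))
  · exact mem_closure_pair_of_eq 1 0 (Units.ext (k.trans (by decide)))
  · exact mem_closure_pair_of_eq 2 0 (Units.ext (k.trans (by decide)))
  · exact mem_closure_pair_of_eq 3 0 (Units.ext (k.trans (by decide)))
  · exact mem_closure_pair_of_eq 0 1 (Units.ext (k.trans (by decide)))
  · exact mem_closure_pair_of_eq 1 1 (Units.ext (k.trans (by decide)))
  · exact mem_closure_pair_of_eq 2 1 (Units.ext (k.trans (by decide)))
  · exact mem_closure_pair_of_eq 3 1 (Units.ext (k.trans (by decide)))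

/-- **`H12` by shape.** A unit `u` of `M₂(𝔽₅)` which commutes with `a = (3 1;3 3)` and has
determinant `1`, or such that `u · f` (`f = diag(1,4)`) commutes with `a` and `det u = -1`, lies in
`H12 = ⟨a, f⟩` (indeed `H12 = ⟨a⟩ ⊔ ⟨a⟩ f` with `⟨a⟩ = 𝔽₅[a]ˣ ∩ SL₂(𝔽₅)`, the norm-one group of
`𝔽₂₅ = 𝔽₅[a]`). [cite: FreitasLeHungSiksek2015, Remark (iii) after Cor. 2.1] -/
theorem mem_H12_of_shape (u : GL (Fin 2) (ZMod 5))
    (h : ((u : Matrix (Fin 2) (Fin 2) (ZMod 5)) * !![3, 1; 3, 3] = !![3, 1; 3, 3] * (u : Matrix (Fin 2) (Fin 2) (ZMod 5)) ∧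
        Matrix.det (u : Matrix (Fin 2) (Fin 2) (ZMod 5)) = 1) ∨
      ((u : Matrix (Fin 2) (Fin 2) (ZMod 5)) * !![1, 0; 0, 4] * !![3, 1; 3, 3] =
          !![3, 1; 3, 3] * ((u : Matrix (Fin 2) (Fin 2) (ZMod 5)) * !![1, 0; 0, 4]) ∧
        Matrix.det (u : Matrix (Fin 2) (Fin 2) (ZMod 5)) = -1)) :
    u ∈ Subgroup.closure ({(⟨!![3, 1; 3, 3], !![3, 4; 2, 3], by decide, by decide⟩ : GL (Fin 2) (ZMod 5)),
      (⟨!![1, 0; 0, 4], !![1, 0; 0, 4], by decide, by decide⟩ : GL (Fin 2) (ZMod 5))} :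
        Set (GL (Fin 2) (ZMod 5))) := by
  obtain ⟨a, b, c, d, hu⟩ := exists_eq_fin_two (u : Matrix (Fin 2) (Fin 2) (ZMod 5))
  rw [hu, Matrix.det_fin_two_of] at h
  simp only [Matrix.mul_fin_two] at h
  have key : !![a, b; c, d] = !![1, 0; 0, 1] ∨ !![a, b; c, d] = !![3, 1; 3, 3] ∨
      !![a, b; c, d] = !![2, 1; 3, 2] ∨ !![a, b; c, d] = !![4, 0; 0, 4] ∨
      !![a, b; c, d] = !![2, 4; 2, 2] ∨ !![a, b; c, d] = !![3, 4; 2, 3] ∨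
      !![a, b; c, d] = !![1, 0; 0, 4] ∨ !![a, b; c, d] = !![3, 4; 3, 2] ∨
      !![a, b; c, d] = !![2, 4; 3, 3] ∨ !![a, b; c, d] = !![4, 0; 0, 1] ∨
      !![a, b; c, d] = !![2, 1; 2, 3] ∨ !![a, b; c, d] = !![3, 1; 2, 2] := by
    clear hu; revert a b c d h; decide
  rw [← hu] at key
  rcases key with k | k | k | k | k | k | k | k | k | k | k | k
  · exact mem_closure_pair_of_eq 0 0 (Units.ext (k.trans (by decide)))
  · exact mem_closure_pair_of_eq 1 0 (Units.ext (k.trans (by decide)))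
  · exact mem_closure_pair_of_eq 2 0 (Units.ext (k.trans (by decide)))
  · exact mem_closure_pair_of_eq 3 0 (Units.ext (k.trans (by decide)))
  · exact mem_closure_pair_of_eq 4 0 (Units.ext (k.trans (by decide)))
  · exact mem_closure_pair_of_eq 5 0 (Units.ext (k.trans (by decide)))
  · exact mem_closure_pair_of_eq 0 1 (Units.ext (k.trans (by decide)))
  · exact mem_closure_pair_of_eq 1 1 (Units.ext (k.trans (by decide)))
  · exact mem_closure_pair_of_eq 2 1 (Units.ext (k.trans (by decide)))
  · exact mem_closure_pair_of_eq 3 1 (Units.ext (k.trans (by decide)))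
  · exact mem_closure_pair_of_eq 4 1 (Units.ext (k.trans (by decide)))
  · exact mem_closure_pair_of_eq 5 1 (Units.ext (k.trans (by decide)))


/-! ## 2. `2 × 2` bookkeeping over `ZMod 5` -/

/-- An element of `GL₂(𝔽₅)` of trace `0` and determinant `-1` is an involution (Cayley–Hamilton).
[folklore] -/
theorem mul_self_eq_one_of_trace_zero (c : GL (Fin 2) (ZMod 5))
    (htr : Matrix.trace (c : Matrix (Fin 2) (Fin 2) (ZMod 5)) = 0)
    (hdet : Matrix.det (c : Matrix (Fin 2) (Fin 2) (ZMod 5)) = -1) : c * c = 1 := by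
  obtain ⟨p, q, r, s, hc⟩ := exists_eq_fin_two (c : Matrix (Fin 2) (Fin 2) (ZMod 5))
  refine Units.ext ?_
  rw [Units.val_mul, Units.val_one, hc]
  rw [hc, Matrix.trace_fin_two_of] at htr
  rw [hc, Matrix.det_fin_two_of] at hdet
  rw [Matrix.mul_fin_two, Matrix.one_fin_two]
  clear hc
  revert p q r s htr hdet; decide

/-- For `g ∈ GL₂(𝔽₅)` of determinant `-1`, `det (g * c) = 1` when `det c = -1`. [folklore] -/
theorem det_mul_eq_one_of_det_eq_neg_one {g c : GL (Fin 2) (ZMod 5)}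
    (hg : Matrix.det (g : Matrix (Fin 2) (Fin 2) (ZMod 5)) = -1)
    (hc : Matrix.det (c : Matrix (Fin 2) (Fin 2) (ZMod 5)) = -1) :
    Matrix.det ((g * c : GL (Fin 2) (ZMod 5)) : Matrix (Fin 2) (Fin 2) (ZMod 5)) = 1 := by
  rw [Units.val_mul, Matrix.det_mul, hg, hc]; norm_num

/-- **Rational canonical form in `GL₂(𝔽₅)`, determinant one.** A non-scalar `g ∈ GL₂(𝔽₅)` with
`det g = 1` is conjugate to one of five normal forms according to its trace `t`:
`t = 0`: `diag(2, 3)`; `t = 1`: the companion matrix `(0 4; 1 1)` (irreducible `X² - X + 1`);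
`t = 2`: the transvection `(1 1; 0 1)`; `t = 3`: `(4 4; 0 4) = -(1 1; 0 1)`; `t = 4`: the companion
matrix `(0 4; 1 4)` (irreducible `X² + X + 1`).  Proof: a cyclic vector `v` (one of `e₀`, `e₁`,
`e₀ + e₁`) gives `P = [v | g v]` with `g P = P · companion(t)` (Cayley–Hamilton), then a fixed
conjugation of the companion matrix for `t = 0, 2, 3`. [folklore] -/
theorem exists_conj_eq_normalForm (g : GL (Fin 2) (ZMod 5))
    (hdet : Matrix.det (g : Matrix (Fin 2) (Fin 2) (ZMod 5)) = 1)
    (hns : ∀ s : ZMod 5, (g : Matrix (Fin 2) (Fin 2) (ZMod 5)) ≠ s • (1 : Matrix (Fin 2) (Fin 2) (ZMod 5))) :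
    ∃ P : GL (Fin 2) (ZMod 5),
      ((P⁻¹ : GL (Fin 2) (ZMod 5)) : Matrix (Fin 2) (Fin 2) (ZMod 5)) * (g : Matrix (Fin 2) (Fin 2) (ZMod 5)) *
          (P : Matrix (Fin 2) (Fin 2) (ZMod 5)) = !![2, 0; 0, 3] ∨
      ((P⁻¹ : GL (Fin 2) (ZMod 5)) : Matrix (Fin 2) (Fin 2) (ZMod 5)) * (g : Matrix (Fin 2) (Fin 2) (ZMod 5)) *
          (P : Matrix (Fin 2) (Fin 2) (ZMod 5)) = !![0, 4; 1, 1] ∨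
      ((P⁻¹ : GL (Fin 2) (ZMod 5)) : Matrix (Fin 2) (Fin 2) (ZMod 5)) * (g : Matrix (Fin 2) (Fin 2) (ZMod 5)) *
          (P : Matrix (Fin 2) (Fin 2) (ZMod 5)) = !![1, 1; 0, 1] ∨
      ((P⁻¹ : GL (Fin 2) (ZMod 5)) : Matrix (Fin 2) (Fin 2) (ZMod 5)) * (g : Matrix (Fin 2) (Fin 2) (ZMod 5)) *
          (P : Matrix (Fin 2) (Fin 2) (ZMod 5)) = !![4, 4; 0, 4] ∨
      ((P⁻¹ : GL (Fin 2) (ZMod 5)) : Matrix (Fin 2) (Fin 2) (ZMod 5)) * (g : Matrix (Fin 2) (Fin 2) (ZMod 5)) *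
          (P : Matrix (Fin 2) (Fin 2) (ZMod 5)) = !![0, 4; 1, 4] := by
  obtain ⟨a, b, c, d, hg⟩ := exists_eq_fin_two (g : Matrix (Fin 2) (Fin 2) (ZMod 5))
  have hns' : ¬ (b = 0 ∧ c = 0 ∧ a = d) := by
    rintro ⟨rfl, rfl, rfl⟩
    refine hns a ?_
    rw [hg]
    ext i j; fin_cases i <;> fin_cases j <;> simp
  rw [hg, Matrix.det_fin_two_of] at hdet
  -- a cyclic vector: `P0` invertible with `g * P0 = P0 * companion`
  have hP0 : ∃ P0 : Matrix (Fin 2) (Fin 2) (ZMod 5), P0.det ≠ 0 ∧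
      !![a, b; c, d] * P0 = P0 * !![0, 4; 1, a + d] := by
    have key : (Matrix.det !![1, a; 0, c] ≠ 0 ∧ !![a, b; c, d] * !![1, a; 0, c] = !![1, a; 0, c] * !![0, 4; 1, a + d]) ∨
        (Matrix.det !![0, b; 1, d] ≠ 0 ∧ !![a, b; c, d] * !![0, b; 1, d] = !![0, b; 1, d] * !![0, 4; 1, a + d]) ∨
        (Matrix.det !![1, a; 1, d] ≠ 0 ∧ !![a, b; c, d] * !![1, a; 1, d] = !![1, a; 1, d] * !![0, 4; 1, a + d]) := by
      simp only [Matrix.det_fin_two_of, Matrix.mul_fin_two]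
      clear hg hns
      revert a b c d hdet hns'; decide
    rcases key with ⟨h1, h2⟩ | ⟨h1, h2⟩ | ⟨h1, h2⟩
    · exact ⟨_, h1, h2⟩
    · exact ⟨_, h1, h2⟩
    · exact ⟨_, h1, h2⟩
  obtain ⟨P0, hP0det, hP0⟩ := hP0
  obtain ⟨P0u, hP0u_val⟩ : ∃ P0u : GL (Fin 2) (ZMod 5), (P0u : Matrix (Fin 2) (Fin 2) (ZMod 5)) = P0 := by
    haveI : Fact (Nat.Prime 5) := ⟨by norm_num⟩
    exact ⟨Matrix.GeneralLinearGroup.mkOfDetNeZero P0 hP0det,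
      Matrix.GeneralLinearGroup.val_mkOfDetNeZero P0 hP0det⟩
  have hconj : ((P0u⁻¹ : GL (Fin 2) (ZMod 5)) : Matrix (Fin 2) (Fin 2) (ZMod 5)) *
      (g : Matrix (Fin 2) (Fin 2) (ZMod 5)) * (P0u : Matrix (Fin 2) (Fin 2) (ZMod 5)) =
      !![0, 4; 1, a + d] := by
    rw [Matrix.mul_assoc, hg, hP0u_val, hP0, ← hP0u_val, ← Matrix.mul_assoc,
      ← Units.val_mul, inv_mul_cancel, Units.val_one, Matrix.one_mul]
  -- conjugating the companion matrix into the chosen normal form, by trace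
  have aux : ∀ (Z : GL (Fin 2) (ZMod 5)) (N : Matrix (Fin 2) (Fin 2) (ZMod 5)),
      ((Z⁻¹ : GL (Fin 2) (ZMod 5)) : Matrix (Fin 2) (Fin 2) (ZMod 5)) * !![0, 4; 1, a + d] *
          (Z : Matrix (Fin 2) (Fin 2) (ZMod 5)) = N →
      (((P0u * Z)⁻¹ : GL (Fin 2) (ZMod 5)) : Matrix (Fin 2) (Fin 2) (ZMod 5)) *
          (g : Matrix (Fin 2) (Fin 2) (ZMod 5)) * ((P0u * Z : GL (Fin 2) (ZMod 5)) : Matrix (Fin 2) (Fin 2) (ZMod 5)) = N := by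
    intro Z N hZ
    rw [← hZ, ← hconj, _root_.mul_inv_rev, Units.val_mul, Units.val_mul]
    simp only [Matrix.mul_assoc]
  have h5cases : ∀ t : ZMod 5, t = 0 ∨ t = 1 ∨ t = 2 ∨ t = 3 ∨ t = 4 := by decide
  rcases h5cases (a + d) with ht | ht | ht | ht | ht <;> rw [ht] at aux
  · refine ⟨P0u * ⟨!![3, 3; 4, 1], !![1, 2; 1, 3], by decide, by decide⟩, Or.inl (aux _ _ ?_)⟩
    decide
  · exact ⟨P0u * 1, Or.inr (Or.inl (aux _ _ (by simp)))⟩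
  · refine ⟨P0u * ⟨!![4, 1; 1, 0], !![0, 1; 1, 1], by decide, by decide⟩, Or.inr (Or.inr (Or.inl (aux _ _ ?_)))⟩
    decide
  · refine ⟨P0u * ⟨!![1, 4; 1, 0], !![0, 1; 4, 1], by decide, by decide⟩,
      Or.inr (Or.inr (Or.inr (Or.inl (aux _ _ ?_))))⟩
    decide
  · exact ⟨P0u * 1, Or.inr (Or.inr (Or.inr (Or.inr (aux _ _ (by simp)))))⟩


/-! ## 3. The spanning hypothesis as a linear functional -/

/-- **A proper span has a non-zero annihilating functional.** If the determinant-one elements of `G`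
do not span `M₂(𝔽₅)`, some non-zero linear functional `φ : M₂(𝔽₅) → 𝔽₅` kills every `g ∈ G` with
`det g = 1`. [folklore] -/
theorem exists_functional {G : Subgroup (GL (Fin 2) (ZMod 5))}
    (hspan : Submodule.span (ZMod 5) ((fun g : GL (Fin 2) (ZMod 5) =>
      ((g : GL (Fin 2) (ZMod 5)) : Matrix (Fin 2) (Fin 2) (ZMod 5))) ''
        {g : GL (Fin 2) (ZMod 5) | g ∈ G ∧
          Matrix.det ((g : GL (Fin 2) (ZMod 5)) : Matrix (Fin 2) (Fin 2) (ZMod 5)) = 1}) ≠ ⊤) :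
    ∃ φ : Matrix (Fin 2) (Fin 2) (ZMod 5) →ₗ[ZMod 5] ZMod 5, φ ≠ 0 ∧
      ∀ g ∈ G, Matrix.det (g : Matrix (Fin 2) (Fin 2) (ZMod 5)) = 1 →
        φ (g : Matrix (Fin 2) (Fin 2) (ZMod 5)) = 0 := by
  haveI : Fact (Nat.Prime 5) := ⟨by norm_num⟩
  obtain ⟨φ, hφ0, hle⟩ := Submodule.exists_le_ker_of_lt_top _ (lt_top_iff_ne_top.2 hspan)
  refine ⟨φ, hφ0, fun g hg hd => ?_⟩
  exact LinearMap.mem_ker.1 (hle (Submodule.subset_span ⟨g, ⟨hg, hd⟩, rfl⟩))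

/-- **Coordinates of a functional on `M₂(𝔽₅)`.** `φ m = Σ m i j · φ E i j` over the four elementary
matrices. [folklore] -/
theorem functional_apply (φ : Matrix (Fin 2) (Fin 2) (ZMod 5) →ₗ[ZMod 5] ZMod 5)
    (m : Matrix (Fin 2) (Fin 2) (ZMod 5)) :
    φ m = m 0 0 * φ !![1, 0; 0, 0] + m 0 1 * φ !![0, 1; 0, 0] + m 1 0 * φ !![0, 0; 1, 0] +
      m 1 1 * φ !![0, 0; 0, 1] := by
  have hm : m = m 0 0 • !![1, 0; 0, 0] + m 0 1 • !![0, 1; 0, 0] + m 1 0 • !![0, 0; 1, 0] +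
      m 1 1 • !![0, 0; 0, 1] := by
    ext i j; fin_cases i <;> fin_cases j <;> simp
  conv_lhs => rw [hm]
  simp only [map_add, map_smul, smul_eq_mul]

/-- A functional with all four coordinates zero is zero. [folklore] -/
theorem functional_eq_zero (φ : Matrix (Fin 2) (Fin 2) (ZMod 5) →ₗ[ZMod 5] ZMod 5)
    (h : φ !![1, 0; 0, 0] = 0 ∧ φ !![0, 1; 0, 0] = 0 ∧ φ !![0, 0; 1, 0] = 0 ∧ φ !![0, 0; 0, 1] = 0) :
    φ = 0 := by
  refine LinearMap.ext fun m => ?_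
  rw [functional_apply, h.1, h.2.1, h.2.2.1, h.2.2.2]
  simp

/-! ## 4. Transport along an inner automorphism `g ↦ y g y⁻¹` -/

/-- Membership in the conjugate subgroup `y G y⁻¹`. [folklore] -/
theorem mem_map_conj_iff {G : Subgroup (GL (Fin 2) (ZMod 5))} {y g : GL (Fin 2) (ZMod 5)} :
    g ∈ G.map (MulAut.conj y).toMonoidHom ↔ y⁻¹ * g * y ∈ G := by
  constructor
  · rintro ⟨h, hh, rfl⟩
    simpa [MulAut.conj_apply, mul_assoc] using hh
  · intro h
    exact ⟨y⁻¹ * g * y, h, by simp [MulAut.conj_apply, mul_assoc]⟩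

/-- `y g y⁻¹` lies in the conjugate subgroup. [folklore] -/
theorem conj_mem_map_conj {G : Subgroup (GL (Fin 2) (ZMod 5))} {y g : GL (Fin 2) (ZMod 5)}
    (hg : g ∈ G) : y * g * y⁻¹ ∈ G.map (MulAut.conj y).toMonoidHom :=
  ⟨g, hg, by simp [MulAut.conj_apply]⟩

/-- Transport of hypothesis (a) `det G ⊆ {±1}`. [folklore] -/
theorem det_transfer {G : Subgroup (GL (Fin 2) (ZMod 5))} (y : GL (Fin 2) (ZMod 5))
    (hdet : ∀ g ∈ G, Matrix.det ((g : GL (Fin 2) (ZMod 5)) : Matrix (Fin 2) (Fin 2) (ZMod 5)) = 1 ∨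
      Matrix.det ((g : GL (Fin 2) (ZMod 5)) : Matrix (Fin 2) (Fin 2) (ZMod 5)) = -1) :
    ∀ g ∈ G.map (MulAut.conj y).toMonoidHom,
      Matrix.det ((g : GL (Fin 2) (ZMod 5)) : Matrix (Fin 2) (Fin 2) (ZMod 5)) = 1 ∨
      Matrix.det ((g : GL (Fin 2) (ZMod 5)) : Matrix (Fin 2) (Fin 2) (ZMod 5)) = -1 := by
  intro g hg
  have h := hdet _ (mem_map_conj_iff.1 hg)
  rwa [Units.val_mul, Units.val_mul, Matrix.det_units_conj'] at h

/-- Transport of hypothesis (b): the odd element. [folklore] -/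
theorem odd_transfer {G : Subgroup (GL (Fin 2) (ZMod 5))} (y : GL (Fin 2) (ZMod 5))
    {c : GL (Fin 2) (ZMod 5)} (hcG : c ∈ G)
    (hctr : Matrix.trace (c : Matrix (Fin 2) (Fin 2) (ZMod 5)) = 0)
    (hcdet : Matrix.det (c : Matrix (Fin 2) (Fin 2) (ZMod 5)) = -1) :
    y * c * y⁻¹ ∈ G.map (MulAut.conj y).toMonoidHom ∧
      Matrix.trace ((y * c * y⁻¹ : GL (Fin 2) (ZMod 5)) : Matrix (Fin 2) (Fin 2) (ZMod 5)) = 0 ∧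
      Matrix.det ((y * c * y⁻¹ : GL (Fin 2) (ZMod 5)) : Matrix (Fin 2) (Fin 2) (ZMod 5)) = -1 := by
  refine ⟨conj_mem_map_conj hcG, ?_, ?_⟩
  · rw [Units.val_mul, Units.val_mul, Matrix.trace_units_conj]; exact hctr
  · rw [Units.val_mul, Units.val_mul, Matrix.det_units_conj]; exact hcdet

/-- Transport of hypothesis (c): no common eigenline. [folklore] -/
theorem irr_transfer {G : Subgroup (GL (Fin 2) (ZMod 5))} (y : GL (Fin 2) (ZMod 5))
    (hirr : ¬ ∃ v : Fin 2 → ZMod 5, v ≠ 0 ∧ ∀ g ∈ G, ∃ a : ZMod 5,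
      ((g : GL (Fin 2) (ZMod 5)) : Matrix (Fin 2) (Fin 2) (ZMod 5)) *ᵥ v = a • v) :
    ¬ ∃ v : Fin 2 → ZMod 5, v ≠ 0 ∧ ∀ g ∈ G.map (MulAut.conj y).toMonoidHom, ∃ a : ZMod 5,
      ((g : GL (Fin 2) (ZMod 5)) : Matrix (Fin 2) (Fin 2) (ZMod 5)) *ᵥ v = a • v := by
  rintro ⟨v, hv, hall⟩
  refine hirr ⟨((y⁻¹ : GL (Fin 2) (ZMod 5)) : Matrix (Fin 2) (Fin 2) (ZMod 5)) *ᵥ v, ?_, fun g hg => ?_⟩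
  · intro h0
    apply hv
    have h1 : ((y : GL (Fin 2) (ZMod 5)) : Matrix (Fin 2) (Fin 2) (ZMod 5)) *ᵥ
        (((y⁻¹ : GL (Fin 2) (ZMod 5)) : Matrix (Fin 2) (Fin 2) (ZMod 5)) *ᵥ v) = 0 := by
      rw [h0, Matrix.mulVec_zero]
    rwa [Matrix.mulVec_mulVec, ← Units.val_mul, mul_inv_cancel, Units.val_one,
      Matrix.one_mulVec] at h1
  · obtain ⟨a, ha⟩ := hall (y * g * y⁻¹) (conj_mem_map_conj hg)
    refine ⟨a, ?_⟩
    have h1 := congr_arg (fun w => ((y⁻¹ : GL (Fin 2) (ZMod 5)) : Matrix (Fin 2) (Fin 2) (ZMod 5)) *ᵥ w) ha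
    simp only [Matrix.mulVec_mulVec, Matrix.mulVec_smul, Units.val_mul] at h1
    rwa [← Matrix.mul_assoc, ← Matrix.mul_assoc, ← Units.val_mul, inv_mul_cancel, Units.val_one,
      Matrix.one_mul, ← Matrix.mulVec_mulVec] at h1

/-- Transport of hypothesis (d), in functional form: a non-zero functional killing `G ∩ SL₂`
transports to one killing `y G y⁻¹ ∩ SL₂`. [folklore] -/
theorem functional_transfer {G : Subgroup (GL (Fin 2) (ZMod 5))} (y : GL (Fin 2) (ZMod 5))
    (φ : Matrix (Fin 2) (Fin 2) (ZMod 5) →ₗ[ZMod 5] ZMod 5) (hφ0 : φ ≠ 0)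
    (hφ : ∀ g ∈ G, Matrix.det (g : Matrix (Fin 2) (Fin 2) (ZMod 5)) = 1 →
      φ (g : Matrix (Fin 2) (Fin 2) (ZMod 5)) = 0) :
    ∃ φ' : Matrix (Fin 2) (Fin 2) (ZMod 5) →ₗ[ZMod 5] ZMod 5, φ' ≠ 0 ∧
      ∀ g ∈ G.map (MulAut.conj y).toMonoidHom, Matrix.det (g : Matrix (Fin 2) (Fin 2) (ZMod 5)) = 1 →
        φ' (g : Matrix (Fin 2) (Fin 2) (ZMod 5)) = 0 := by
  refine ⟨φ ∘ₗ ((LinearMap.mulLeft (ZMod 5) ((y⁻¹ : GL (Fin 2) (ZMod 5)) : Matrix (Fin 2) (Fin 2) (ZMod 5))) ∘ₗ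
    (LinearMap.mulRight (ZMod 5) ((y : GL (Fin 2) (ZMod 5)) : Matrix (Fin 2) (Fin 2) (ZMod 5)))), ?_, ?_⟩
  · intro h0
    apply hφ0
    refine LinearMap.ext fun m => ?_
    have h1 := LinearMap.congr_fun h0 (((y : GL (Fin 2) (ZMod 5)) : Matrix (Fin 2) (Fin 2) (ZMod 5)) * m *
      ((y⁻¹ : GL (Fin 2) (ZMod 5)) : Matrix (Fin 2) (Fin 2) (ZMod 5)))
    simp only [LinearMap.comp_apply, LinearMap.mulLeft_apply, LinearMap.mulRight_apply,
      LinearMap.zero_apply] at h1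
    rwa [Matrix.mul_assoc _ _ ((y : GL (Fin 2) (ZMod 5)) : Matrix (Fin 2) (Fin 2) (ZMod 5)),
      ← Units.val_mul, inv_mul_cancel, Units.val_one, Matrix.mul_one, ← Matrix.mul_assoc,
      ← Units.val_mul, inv_mul_cancel, Units.val_one, Matrix.one_mul, ← LinearMap.zero_apply (σ₁₂ := RingHom.id (ZMod 5)) m] at h1
  · intro g hg hd
    have hmem := mem_map_conj_iff.1 hg
    have h1 := hφ _ hmem (by rw [Units.val_mul, Units.val_mul, Matrix.det_units_conj']; exact hd)
    simp only [LinearMap.comp_apply, LinearMap.mulLeft_apply, LinearMap.mulRight_apply]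
    rw [Units.val_mul, Units.val_mul, Matrix.mul_assoc] at h1
    exact h1

/-- Transport of the CONCLUSION back along the conjugation: if `y G y⁻¹` is conjugate into `H8`
or into `H12`, so is `G`. [folklore] -/
theorem concl_transfer {G : Subgroup (GL (Fin 2) (ZMod 5))} (y : GL (Fin 2) (ZMod 5))
    (h : ∃ x : GL (Fin 2) (ZMod 5), (∀ g ∈ G.map (MulAut.conj y).toMonoidHom, x * g * x⁻¹ ∈ Subgroup.closure ({(⟨!![2, 0; 0, 3], !![3, 0; 0, 2], by decide, by decide⟩ : GL (Fin 2) (ZMod 5)),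
      (⟨!![0, 1; 1, 0], !![0, 1; 1, 0], by decide, by decide⟩ : GL (Fin 2) (ZMod 5))} : Set (GL (Fin 2) (ZMod 5)))) ∨
      (∀ g ∈ G.map (MulAut.conj y).toMonoidHom, x * g * x⁻¹ ∈ Subgroup.closure ({(⟨!![3, 1; 3, 3], !![3, 4; 2, 3], by decide, by decide⟩ : GL (Fin 2) (ZMod 5)),
      (⟨!![1, 0; 0, 4], !![1, 0; 0, 4], by decide, by decide⟩ : GL (Fin 2) (ZMod 5))} : Set (GL (Fin 2) (ZMod 5))))) :
    ∃ x : GL (Fin 2) (ZMod 5), (∀ g ∈ G, x * g * x⁻¹ ∈ Subgroup.closure ({(⟨!![2, 0; 0, 3], !![3, 0; 0, 2], by decide, by decide⟩ : GL (Fin 2) (ZMod 5)),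
      (⟨!![0, 1; 1, 0], !![0, 1; 1, 0], by decide, by decide⟩ : GL (Fin 2) (ZMod 5))} : Set (GL (Fin 2) (ZMod 5)))) ∨ (∀ g ∈ G, x * g * x⁻¹ ∈ Subgroup.closure ({(⟨!![3, 1; 3, 3], !![3, 4; 2, 3], by decide, by decide⟩ : GL (Fin 2) (ZMod 5)),
      (⟨!![1, 0; 0, 4], !![1, 0; 0, 4], by decide, by decide⟩ : GL (Fin 2) (ZMod 5))} : Set (GL (Fin 2) (ZMod 5)))) := by
  obtain ⟨x, hx⟩ := h
  refine ⟨x * y, ?_⟩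
  have key : ∀ g : GL (Fin 2) (ZMod 5), x * y * g * (x * y)⁻¹ = x * (y * g * y⁻¹) * x⁻¹ := fun g => by group
  rcases hx with h8 | h12
  · exact Or.inl fun g hg => by rw [key]; exact h8 _ (conj_mem_map_conj hg)
  · exact Or.inr fun g hg => by rw [key]; exact h12 _ (conj_mem_map_conj hg)

end Summit.Langlands.Langlands.Theorems.GroupCensusFive
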